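import Summits.QuantumFields.BalabanUV.Beta.WardLocusRecursiveLetters
import Summits.QuantumFields.BalabanUV.Beta.WilsonBiStencilWardSocket

/-!
# `BalabanUV.Beta.WardLocusWilsonZero` — binder row D1, (L4) W-side of hW: THE LEVEL-0 WILSON WARD LETTER OF THE hW CHAIN IS IN THE TREE FOR THE
# NORMALISED QUARTIC TABLE `T := t • wsym22 N`, with its UNITS LOCK DISPLAYED — leaf-09-g4's `WilsonBiStencilWardSocket.hS₂_wilson` / `hS₂''_wilson` plugged
# into the socket `hWil` / `hWil''` of `WardLocusRecursiveLetters`; the lock arithmetic (at the pin `cE₂ = Lc^{2(d+1)}` the letter holds with ZERO remainder iff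
# `t = (8N²)⁻¹`); and hW(v2.26-W) FROM an1's TWO LETTERS ONLY (border, mixed) for that `T`
# (β sub-cell, D1 formalisation swarm, unit `b2b-balaban-beta-d1-formalise-leaf-06`, gen 3; CLAIM «D1-hW-L4-WARD-ALL» journal 2026-08-20)

NOT IN PRINT; OUR BOOKKEEPING.  HONEST FRAMING (cell charter, verbatim): «discharging `BetaPertH` makes Bałaban's UV stability UNCONDITIONAL — a real
constructive-QFT result; it is NOT the continuum limit and NOT the Clay problem.»  HONEST DEPENDENCY (verbatim): «continuum YM on T⁴ ⇐ BetaPertH ∧ nine spine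
estimates (0/9 proved); BetaPertH ⇐ (D1) ∧ (D4) ∧ CAP+tail; G-an2-4 gates asym, D1 and NE2/3/4.»  [folklore] composition + scalar bookkeeping; an1's border and
mixed letters, their classes/parities, the pin and the Wilson lock stay DISPLAYED HYPOTHESES; the normalisation `t` of the quartic table is NOT chosen here
((R45)/(P6), an2-g19's (A1) «`T := wsym22 N`»): §2 only RECORDS what each choice forces; no statement of Bałaban's papers, no `[cite:]`, no `def`, no
`def … : Prop`; instantiates NO binder of the β-function wall.  NOT hW closed, NOT D1, NOT `BetaPertH`, NOT continuum, NOT Clay.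

* §1 `hWil_wsym22` / `hWil''_wsym22` (generic `d`; a colour basis `τ` with `Complete τ`, `TrOrthonormal τ`, `N ≠ 0`, a colour `cc` — leaf-09's hypotheses, absent
  from the conclusion): for `T := t • wsym22 N` the level-0 Wilson socket of `WardLocusRecursiveLetters` HOLDS WITH ZERO REMAINDER under the lock
  `((stepScale 0·Lc^{d+1})⁻¹·(cE₂·t))·4N² = Lc^{d+1}·½` (`wilsonW₂_smul`, `divV_smul`, `hS₂_wilson` with `cH := cH₀·cE₂·t`, `c := Lc^{d+1}`, `ξ := ½`).
* §2 `wilsonLock_iff` — that lock ⟺ `cE₂·t = Lc^{2(d+1)}∕(8N²)`; `wilsonLock_pin_iff` — AT THE PIN `cE₂ = Lc^{2(d+1)}` (forced by the `e4OfKW` sector at every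
  level ≥ 1, `WardLocusQuarticTable.lock_succ_of_pin`) it holds iff `t·8N² = 1`; `not_wilsonLock_pin_one` — so NOT for `t = 1` (`T := wsym22 N` unscaled) once
  `1 ≤ N`.  LOCATED UNITS QUESTION «HW-L0-WILSON-LOCK» for (P6): the Ward-consistent normalisation of the level-0 quartic table in the hW chain is
  `T := (8N²)⁻¹ • wsym22 N` (equivalently a factor `(8N²)⁻¹` in the level-0 coefficient) — recorded, not ruled.
* §3 **`wardTransversal_flipK_TbalOf_JsRecWAtOf_of_border_mixed_letters`** (`d = 3`, `T := t • wsym22 N` with `t·8N² = 1`, pin `cE₂ = Lc⁸`):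
  hW(v2.26-W) ⟸ EXACTLY an1's BORDER letter (both slots, every level) and MIXED letter (every level) with their remainder classes / parities, + `hBt`/`hmixt` —
  the Wilson letter and its remainder sockets DISCHARGED (`RW = RW″ = 0`: `biLoc_zero`, `parityOdd_zero`).
Provenance: D1 formalisation swarm, leaf prover 06 (gen 3), 2026-08-20; no existing file touched.
-/

noncomputable section

open Finset
open scoped BigOperators
open Literature.MathematicalPhysics.QuantumFieldTheory
open Literature.MathematicalPhysics.QuantumFieldTheory.Balaban1983to89
open Literature.MathematicalPhysics.QuantumFieldTheory.Balaban1983to89.Beta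
open ExpKernelCalculus (MKer Decays BiLoc VertexFamily VertexFamily₂ comp shiftK)
open KernelWard (divV divW)
open AffineAveraging (Site box toSite)
open OneStepResolventKernel (Fib LocStencil)
open OneStepKernelFamily (KInvStep TbalOf flipK)
open PolarizationSign (WardTransversal)
open BalabanStepJetsSucc (wE wVH)
open SecondOrderResponse (LocStencilFM)
open BalabanCompositeJets (LocStencil₂)
open BalabanStepW2 (M2Of wV4 wB2)
open StepJetData (wilsonA)
open WilsonBiStencil (wilsonW₂ wilsonW₂_smul)
open WilsonVertex2Sym (wsym22)
open ColourTrace (Complete TrOrthonormal)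
open AveragingHessianKernelsRooted (vhSAt)
open HessKerRate (biLoc_zero)
open Summit.QuantumFields.BalabanUV.Beta.TameKernelCalculus
open Summit.QuantumFields.BalabanUV.Beta.BorderedHessian (diagK stepScale sgnK)
open Summit.QuantumFields.BalabanUV.Beta.AveragingWardRootedStencils (legInd)
open Summit.QuantumFields.BalabanUV.Beta.SpineRooted (M1At JsRecWAtOf)
open Summit.QuantumFields.BalabanUV.Beta.WardLocusQuartic (divV_smul)
open Summit.QuantumFields.BalabanUV.Beta.SpineRecursiveParity (parityOdd_zero)
open Summit.QuantumFields.BalabanUV.Beta.WilsonBiStencilWardSocket (hS₂_wilson hS₂''_wilson)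
open Summit.QuantumFields.BalabanUV.Beta.WardLocusRecursiveLetters (wardTransversal_flipK_TbalOf_JsRecWAtOf_of_letters)

namespace Summit.QuantumFields.BalabanUV.Beta.WardLocusWilsonZero

/-! ## §1 The level-0 Wilson socket for `T := t • wsym22 N`, zero remainder -/

section Wilson

variable {d Lc N : ℕ} {C : Type*} [Fintype C] [DecidableEq C] {τ : C → Matrix (Fin N) (Fin N) ℂ}

/-- [folklore] **THE LEVEL-0 WILSON WARD LETTER, FIRST SLOT, FOR `T := t • wsym22 N`, ZERO REMAINDER**: the `hWil` socket of
`WardLocusRecursiveLetters.exists_kernelLaws_of_letters` with `RW := 0`, from leaf-09-g4's `hS₂_wilson` under the lock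
`((stepScale 0·Lc^{d+1})⁻¹·(cE₂·t))·(4N²) = Lc^{d+1}·½` (`wilsonW₂_smul`, `divV_smul`). -/
theorem hWil_wsym22 (hτ : Complete τ) (ho : TrOrthonormal τ) (hN : N ≠ 0) (cc : C) (r : Fin (d + 1) → ℕ) (cE₂ t : ℝ)
    (hlockW : (stepScale d Lc 0 * (Lc : ℝ) ^ (d + 1))⁻¹ * (cE₂ * t) * (4 * (N : ℝ) ^ 2) = (Lc : ℝ) ^ (d + 1) * ((1 : ℝ) / 2))
    (Y : Fin (d + 1) → ℤ) (κ' : Fin (d + 1)) (u' : Fin (d + 1) → ℤ) :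
    (stepScale d Lc 0 * (Lc : ℝ) ^ (d + 1))⁻¹ • ∑ v ∈ box (d + 1) Lc,
        divV (fun κ u => cE₂ • wilsonW₂ d (t • wsym22 N) κ u κ' u') ((Lc : ℤ) • Y + toSite v) =
      comp (((Lc : ℝ) ^ (d + 1)) • wilsonA d κ' u') (diagK (((1 : ℝ) / 2) • ∑ v ∈ box (d + 1) Lc, legInd (toSite r) ((Lc : ℤ) • Y + toSite v)))
        - comp (diagK (((1 : ℝ) / 2) • ∑ v ∈ box (d + 1) Lc, legInd (toSite r) ((Lc : ℤ) • Y + toSite v))) (((Lc : ℝ) ^ (d + 1)) • wilsonA d κ' u')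
        + (fun (_ : Fin (d + 1) → ℤ) (_ : Fin (d + 1)) (_ : Fin (d + 1) → ℤ) => (0 : MKer (d + 1) (Fib d))) Y κ' u' := by
  have h1 : ∀ w : Fin (d + 1) → ℤ, divV (fun κ u => cE₂ • wilsonW₂ d (t • wsym22 N) κ u κ' u') w =
      (cE₂ * t) • divV (fun κ u => wilsonW₂ d (wsym22 N) κ u κ' u') w := by
    intro w
    have : (fun κ u => cE₂ • wilsonW₂ d (t • wsym22 N) κ u κ' u') = fun κ u => (cE₂ * t) • wilsonW₂ d (wsym22 N) κ u κ' u' := by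
      funext κ u; rw [wilsonW₂_smul, smul_smul]
    rw [this]
    exact divV_smul (cE₂ * t) (fun κ u => wilsonW₂ d (wsym22 N) κ u κ' u') w
  simp_rw [h1]
  rw [← Finset.smul_sum, smul_smul]
  exact hS₂_wilson hτ ho hN cc Lc (toSite r) hlockW Y κ' u'

/-- [folklore] **THE SAME, SECOND SLOT** (`hS₂''_wilson`). -/
theorem hWil''_wsym22 (hτ : Complete τ) (ho : TrOrthonormal τ) (hN : N ≠ 0) (cc : C) (r : Fin (d + 1) → ℕ) (cE₂ t : ℝ)
    (hlockW : (stepScale d Lc 0 * (Lc : ℝ) ^ (d + 1))⁻¹ * (cE₂ * t) * (4 * (N : ℝ) ^ 2) = (Lc : ℝ) ^ (d + 1) * ((1 : ℝ) / 2))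
    (Y : Fin (d + 1) → ℤ) (κ : Fin (d + 1)) (u : Fin (d + 1) → ℤ) :
    (stepScale d Lc 0 * (Lc : ℝ) ^ (d + 1))⁻¹ • ∑ v ∈ box (d + 1) Lc,
        divV (fun κ' u' => cE₂ • wilsonW₂ d (t • wsym22 N) κ u κ' u') ((Lc : ℤ) • Y + toSite v) =
      comp (((Lc : ℝ) ^ (d + 1)) • wilsonA d κ u) (diagK (((1 : ℝ) / 2) • ∑ v ∈ box (d + 1) Lc, legInd (toSite r) ((Lc : ℤ) • Y + toSite v)))
        - comp (diagK (((1 : ℝ) / 2) • ∑ v ∈ box (d + 1) Lc, legInd (toSite r) ((Lc : ℤ) • Y + toSite v))) (((Lc : ℝ) ^ (d + 1)) • wilsonA d κ u)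
        + (fun (_ : Fin (d + 1) → ℤ) (_ : Fin (d + 1)) (_ : Fin (d + 1) → ℤ) => (0 : MKer (d + 1) (Fib d))) Y κ u := by
  have h1 : ∀ w : Fin (d + 1) → ℤ, divV (fun κ' u' => cE₂ • wilsonW₂ d (t • wsym22 N) κ u κ' u') w =
      (cE₂ * t) • divV (wilsonW₂ d (wsym22 N) κ u) w := by
    intro w
    have : (fun κ' u' => cE₂ • wilsonW₂ d (t • wsym22 N) κ u κ' u') = fun κ' u' => (cE₂ * t) • wilsonW₂ d (wsym22 N) κ u κ' u' := by
      funext κ' u'; rw [wilsonW₂_smul, smul_smul]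
    rw [this]
    exact divV_smul (cE₂ * t) (wilsonW₂ d (wsym22 N) κ u) w
  simp_rw [h1]
  rw [← Finset.smul_sum, smul_smul]
  exact hS₂''_wilson hτ ho hN cc Lc (toSite r) hlockW Y κ u

end Wilson

/-! ## §2 The lock arithmetic: what each normalisation of the quartic table forces -/

section Lock

variable {d Lc N : ℕ}

/-- [folklore] **THE WILSON LOCK ⟺ `cE₂·t = Lc^{2(d+1)}∕(8N²)`** (`Lc ≠ 0`, `N ≠ 0`; `stepScale 0 = 1`). -/
theorem wilsonLock_iff (hLc : Lc ≠ 0) (hN : N ≠ 0) (cE₂ t : ℝ) :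
    (stepScale d Lc 0 * (Lc : ℝ) ^ (d + 1))⁻¹ * (cE₂ * t) * (4 * (N : ℝ) ^ 2) = (Lc : ℝ) ^ (d + 1) * ((1 : ℝ) / 2) ↔
      cE₂ * t = (Lc : ℝ) ^ (2 * (d + 1)) / (8 * (N : ℝ) ^ 2) := by
  have hL : (Lc : ℝ) ≠ 0 := Nat.cast_ne_zero.2 hLc
  have hNr : (N : ℝ) ≠ 0 := Nat.cast_ne_zero.2 hN
  have hs : stepScale d Lc 0 = 1 := by simp [BorderedHessian.stepScale]
  rw [hs, one_mul, pow_mul]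
  constructor
  · intro h
    field_simp at h ⊢
    linear_combination h
  · intro h
    rw [h]
    field_simp
    ring

/-- [folklore] **AT THE PIN `cE₂ = Lc^{2(d+1)}` THE WILSON LOCK HOLDS IFF `t·(8N²) = 1`** — the `e4OfKW` sector pins `cE₂` at every level ≥ 1
(`WardLocusQuarticTable.lock_succ_of_pin`), so the level-0 Wilson letter with zero remainder fixes the normalisation of the quartic table. -/
theorem wilsonLock_pin_iff (hLc : Lc ≠ 0) (hN : N ≠ 0) (t : ℝ) :
    (stepScale d Lc 0 * (Lc : ℝ) ^ (d + 1))⁻¹ * ((Lc : ℝ) ^ (2 * (d + 1)) * t) * (4 * (N : ℝ) ^ 2) = (Lc : ℝ) ^ (d + 1) * ((1 : ℝ) / 2) ↔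
      t * (8 * (N : ℝ) ^ 2) = 1 := by
  rw [wilsonLock_iff hLc hN]
  have hL : (Lc : ℝ) ^ (2 * (d + 1)) ≠ 0 := pow_ne_zero _ (Nat.cast_ne_zero.2 hLc)
  have hNr : (8 : ℝ) * (N : ℝ) ^ 2 ≠ 0 := by positivity
  constructor
  · intro h
    have := (div_eq_iff hNr).1 h.symm
    -- Lc^{2(d+1)} = Lc^{2(d+1)} * t * (8 N²)
    have h2 : (Lc : ℝ) ^ (2 * (d + 1)) * (t * (8 * (N : ℝ) ^ 2)) = (Lc : ℝ) ^ (2 * (d + 1)) * 1 := by linear_combination -this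
    exact mul_left_cancel₀ hL h2
  · intro h
    rw [eq_div_iff hNr]
    linear_combination (Lc : ℝ) ^ (2 * (d + 1)) * h

/-- [folklore] **HENCE `T := wsym22 N` UNSCALED (`t = 1`) DOES NOT SATISFY THE WILSON LOCK AT THE PIN** once `1 ≤ N` (then `8N² ≠ 1`) — the located units
question «HW-L0-WILSON-LOCK»: the Ward-consistent normalisation is `t = (8N²)⁻¹` (`wilsonLock_pin_iff`); recorded for (P6), not ruled. -/
theorem not_wilsonLock_pin_one (hLc : Lc ≠ 0) (hN : 1 ≤ N) :
    ¬ ((stepScale d Lc 0 * (Lc : ℝ) ^ (d + 1))⁻¹ * ((Lc : ℝ) ^ (2 * (d + 1)) * 1) * (4 * (N : ℝ) ^ 2) = (Lc : ℝ) ^ (d + 1) * ((1 : ℝ) / 2)) := by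
  rw [wilsonLock_pin_iff hLc (by omega)]
  have hN1 : (1 : ℝ) ≤ (N : ℝ) := by exact_mod_cast hN
  intro h
  nlinarith

end Lock

/-! ## §3 hW(v2.26-W) from an1's two letters only, for the normalised quartic table (`d = 3`) -/

section End

variable {Lc N : ℕ} [NeZero Lc] {C : Type*} [Fintype C] [DecidableEq C] {τ : C → Matrix (Fin N) (Fin N) ℂ}

/-- [folklore] **hW FOR THE RECURSIVE W-LITERAL WITH THE NORMALISED WILSON QUARTIC TABLE, FROM an1's BORDER AND MIXED LETTERS ONLY** (`d = 3`, `Lc ≥ 1`,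
in-block root, a colour basis (`Complete τ`, `TrOrthonormal τ`, `N ≠ 0`, a colour `cc`), quartic table `T := t • wsym22 N` with `t·(8N²) = 1`, pin `cE₂ = Lc⁸`):
the border Ward letter (both slots, every level) and the mixed Ward letter (every level) with their remainders' classes (one rate per level) and row parities,
+ `hBt`/`hmixt`, give `∀ j, WardTransversal (flipK (TbalOf Lc (JsRecWAtOf hLc hr Lc⁴ (−Lc⁴·½·Lc⁴) cΛ cE₂ cB (t • wsym22 N) hB hmix) j))` —
`WardLocusRecursiveLetters.wardTransversal_flipK_TbalOf_JsRecWAtOf_of_letters` with the Wilson sockets discharged by §1 (`RW = RW″ = 0`, classes `biLoc_zero`,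
parities `parityOdd_zero`). -/
theorem wardTransversal_flipK_TbalOf_JsRecWAtOf_of_border_mixed_letters (hτ : Complete τ) (ho : TrOrthonormal τ) (hN : N ≠ 0) (cc : C)
    (hLc : 1 ≤ Lc) {r : Fin (3 + 1) → ℕ} (hr : r ∈ box (3 + 1) Lc) (cΛ cB : ℝ) {cE₂ t : ℝ}
    (hcE₂ : cE₂ = (Lc : ℝ) ^ (2 * (3 + 1))) (ht : t * (8 * (N : ℝ) ^ 2) = 1)
    {vh₂S : Fin (3 + 1) → (Fin (3 + 1) → ℤ) → Fin (3 + 1) → (Fin (3 + 1) → ℤ) → MKer (3 + 1) (Fib 3)}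
    (hB : ∃ C δ : ℝ, 0 < δ ∧ LocStencil₂ vh₂S C δ)
    (hBt : ∀ (κ : Fin (3 + 1)) (u : Fin (3 + 1) → ℤ) (κ' : Fin (3 + 1)) (u' t : Fin (3 + 1) → ℤ),
      vh₂S κ (u + (Lc : ℤ) • t) κ' (u' + (Lc : ℤ) • t) = shiftK (-((Lc : ℤ) • t)) (vh₂S κ u κ' u'))
    {mixFF : Fin (3 + 1) → (Fin (3 + 1) → ℤ) → Fin (3 + 1) → (Fin (3 + 1) → ℤ) → MKer (3 + 1) (Fib 3)}
    (hmix : ∃ C δ : ℝ, 0 < δ ∧ LocStencilFM Lc mixFF C δ)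
    (hmixt : ∀ (κ : Fin (3 + 1)) (u : Fin (3 + 1) → ℤ) (μ : Fin (3 + 1)) (w t : Fin (3 + 1) → ℤ),
      mixFF κ (u + (Lc : ℤ) • t) μ (w + t) = shiftK (-((Lc : ℤ) • t)) (mixFF κ u μ w))
    {RB RB'' : ℕ → (Fin (3 + 1) → ℤ) → Fin (3 + 1) → (Fin (3 + 1) → ℤ) → MKer (3 + 1) (Fib 3)} {RM : ℕ → (Fin (3 + 1) → ℤ) → Fin (3 + 1) → (Fin (3 + 1) → ℤ) → MKer (3 + 1) (Fib 3)}
    (hcls0 : ∃ C δ : ℝ, 0 < δ ∧ (∀ Y, LocStencil (RB 0 Y) C δ) ∧ (∀ Y, LocStencil (RB'' 0 Y) C δ) ∧ (∀ y, VertexFamily (RM 0 y) Lc C δ))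
    (hclsS : ∀ j : ℕ, ∃ C δ : ℝ, 0 < δ ∧ (∀ Y, LocStencil (RB (j + 1) Y) C δ) ∧ (∀ Y, LocStencil (RB'' (j + 1) Y) C δ) ∧
      (∀ y, VertexFamily (RM (j + 1) y) Lc C δ))
    (hRBp : ∀ j Y κ u, trK (RB j Y κ u) = -sgnK (RB j Y κ u)) (hRB''p : ∀ j Y κ u, trK (RB'' j Y κ u) = -sgnK (RB'' j Y κ u))
    (hRMp : ∀ j y ρ' w, trK (RM j y ρ' w) = -sgnK (RM j y ρ' w))
    (hBord0 : ∀ (Y : Fin (3 + 1) → ℤ) (κ' : Fin (3 + 1)) (u' : Fin (3 + 1) → ℤ),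
      (stepScale 3 Lc 0 * (Lc : ℝ) ^ (3 + 1))⁻¹ • ∑ v ∈ box (3 + 1) Lc, divV (fun κ u => cB • vh₂S κ u κ' u') ((Lc : ℤ) • Y + toSite v) =
        comp ((-((Lc : ℝ) ^ (3 + 1) * (1 / 2) * (Lc : ℝ) ^ (3 + 1))) • vhSAt (toSite r) 3 Lc rfl κ' u') (diagK (((1 : ℝ) / 2) • ∑ v ∈ box (3 + 1) Lc, legInd (toSite r) ((Lc : ℤ) • Y + toSite v)))
          - comp (diagK (((1 : ℝ) / 2) • ∑ v ∈ box (3 + 1) Lc, legInd (toSite r) ((Lc : ℤ) • Y + toSite v))) ((-((Lc : ℝ) ^ (3 + 1) * (1 / 2) * (Lc : ℝ) ^ (3 + 1))) • vhSAt (toSite r) 3 Lc rfl κ' u')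
          + RB 0 Y κ' u')
    (hBord0'' : ∀ (Y : Fin (3 + 1) → ℤ) (κ : Fin (3 + 1)) (u : Fin (3 + 1) → ℤ),
      (stepScale 3 Lc 0 * (Lc : ℝ) ^ (3 + 1))⁻¹ • ∑ v ∈ box (3 + 1) Lc, divV (fun κ' u' => cB • vh₂S κ u κ' u') ((Lc : ℤ) • Y + toSite v) =
        comp ((-((Lc : ℝ) ^ (3 + 1) * (1 / 2) * (Lc : ℝ) ^ (3 + 1))) • vhSAt (toSite r) 3 Lc rfl κ u) (diagK (((1 : ℝ) / 2) • ∑ v ∈ box (3 + 1) Lc, legInd (toSite r) ((Lc : ℤ) • Y + toSite v)))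
          - comp (diagK (((1 : ℝ) / 2) • ∑ v ∈ box (3 + 1) Lc, legInd (toSite r) ((Lc : ℤ) • Y + toSite v))) ((-((Lc : ℝ) ^ (3 + 1) * (1 / 2) * (Lc : ℝ) ^ (3 + 1))) • vhSAt (toSite r) 3 Lc rfl κ u)
          + RB'' 0 Y κ u)
    (hBordS : ∀ (j : ℕ) (Y : Fin (3 + 1) → ℤ) (κ' : Fin (3 + 1)) (u' : Fin (3 + 1) → ℤ),
      (stepScale 3 Lc (j + 1) * (Lc : ℝ) ^ (3 + 1))⁻¹ •
          ∑ v ∈ box (3 + 1) Lc, divV (fun κ u => (cB * wB2 3 Lc (j + 1)) • vh₂S κ u κ' u') ((Lc : ℤ) • Y + toSite v) =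
        comp ((-((Lc : ℝ) ^ (3 + 1) * (1 / 2) * (Lc : ℝ) ^ (3 + 1)) * wVH 3 Lc (j + 1)) • vhSAt (toSite r) 3 Lc rfl κ' u') (diagK (((1 : ℝ) / 2) • ∑ v ∈ box (3 + 1) Lc, legInd (toSite r) ((Lc : ℤ) • Y + toSite v)))
          - comp (diagK (((1 : ℝ) / 2) • ∑ v ∈ box (3 + 1) Lc, legInd (toSite r) ((Lc : ℤ) • Y + toSite v))) ((-((Lc : ℝ) ^ (3 + 1) * (1 / 2) * (Lc : ℝ) ^ (3 + 1)) * wVH 3 Lc (j + 1)) • vhSAt (toSite r) 3 Lc rfl κ' u')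
          + RB (j + 1) Y κ' u')
    (hBordS'' : ∀ (j : ℕ) (Y : Fin (3 + 1) → ℤ) (κ : Fin (3 + 1)) (u : Fin (3 + 1) → ℤ),
      (stepScale 3 Lc (j + 1) * (Lc : ℝ) ^ (3 + 1))⁻¹ •
          ∑ v ∈ box (3 + 1) Lc, divV (fun κ' u' => (cB * wB2 3 Lc (j + 1)) • vh₂S κ u κ' u') ((Lc : ℤ) • Y + toSite v) =
        comp ((-((Lc : ℝ) ^ (3 + 1) * (1 / 2) * (Lc : ℝ) ^ (3 + 1)) * wVH 3 Lc (j + 1)) • vhSAt (toSite r) 3 Lc rfl κ u) (diagK (((1 : ℝ) / 2) • ∑ v ∈ box (3 + 1) Lc, legInd (toSite r) ((Lc : ℤ) • Y + toSite v)))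
          - comp (diagK (((1 : ℝ) / 2) • ∑ v ∈ box (3 + 1) Lc, legInd (toSite r) ((Lc : ℤ) • Y + toSite v))) ((-((Lc : ℝ) ^ (3 + 1) * (1 / 2) * (Lc : ℝ) ^ (3 + 1)) * wVH 3 Lc (j + 1)) • vhSAt (toSite r) 3 Lc rfl κ u)
          + RB'' (j + 1) Y κ u)
    (hM₂ : ∀ (j : ℕ) (y : Fin (3 + 1) → ℤ) (ρ' : Fin (3 + 1)) (w : Fin (3 + 1) → ℤ),
      (stepScale 3 Lc j * (Lc : ℝ) ^ (3 + 1))⁻¹ • ∑ v ∈ box (3 + 1) Lc, divV (fun κ u => M2Of 3 Lc mixFF j κ u ρ' w) ((Lc : ℤ) • y + toSite v) =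
        comp (M1At 3 Lc (toSite r) cΛ j ρ' w) (diagK (((1 : ℝ) / 2) • ∑ v ∈ box (3 + 1) Lc, legInd (toSite r) ((Lc : ℤ) • y + toSite v)))
          - comp (diagK (((1 : ℝ) / 2) • ∑ v ∈ box (3 + 1) Lc, legInd (toSite r) ((Lc : ℤ) • y + toSite v))) (M1At 3 Lc (toSite r) cΛ j ρ' w)
          + RM j y ρ' w) :
    ∀ j : ℕ, WardTransversal (flipK (TbalOf Lc
      (JsRecWAtOf (d := 3) hLc hr ((Lc : ℝ) ^ (3 + 1)) (-((Lc : ℝ) ^ (3 + 1) * (1 / 2) * (Lc : ℝ) ^ (3 + 1))) cΛ cE₂ cB (t • wsym22 N) hB hmix) j)) := by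
  have hLc0 : Lc ≠ 0 := by omega
  have hlockW : (stepScale 3 Lc 0 * (Lc : ℝ) ^ (3 + 1))⁻¹ * (cE₂ * t) * (4 * (N : ℝ) ^ 2) = (Lc : ℝ) ^ (3 + 1) * ((1 : ℝ) / 2) := by
    rw [hcE₂]
    exact (wilsonLock_pin_iff (d := 3) hLc0 hN t).2 ht
  obtain ⟨C0, δ0, hδ0, hRBl, hRB''l, hRMl⟩ := hcls0
  have hC0 : 0 ≤ C0 := (hRMl 0 0 0).nonneg (Sum.inl 0)
  have hZ : ∀ Y : Fin (3 + 1) → ℤ, LocStencil (fun (_ : Fin (3 + 1)) (_ : Fin (3 + 1) → ℤ) => (0 : MKer (3 + 1) (Fib 3))) C0 δ0 :=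
    fun Y κ u x z a b => by
      simp only [Pi.zero_apply, abs_zero]
      exact mul_nonneg hC0 (Real.exp_pos _).le
  exact wardTransversal_flipK_TbalOf_JsRecWAtOf_of_letters hLc hr cΛ cB hcE₂ (t • wsym22 N) hB hmix
    (RW := fun _ _ _ => 0) (RW'' := fun _ _ _ => 0)
    ⟨C0, δ0, hδ0, hZ, hZ, hRBl, hRB''l, hRMl⟩ hclsS (fun Y κ u => parityOdd_zero) (fun Y κ u => parityOdd_zero) hRBp hRB''p hRMp
    (hWil_wsym22 hτ ho hN cc r cE₂ t hlockW) (hWil''_wsym22 hτ ho hN cc r cE₂ t hlockW) hBord0 hBord0'' hBordS hBordS'' hM₂ hBt hmixt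

end End

end Summit.QuantumFields.BalabanUV.Beta.WardLocusWilsonZero

end
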